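import Literature.AlgebraicGeometry.Resolution.RegularCentreBlowupOrder
import Literature.AlgebraicGeometry.Resolution.GenericPointStalkData
import Literature.AlgebraicGeometry.Resolution.BlowupChartMembership
import HarnessLib

/-!
# Orders at a generic point of the exceptional divisor of a blowing up (the exceptional valuation is the
# `𝔪`-adic order at the generic point of the centre)

Topic: `Literature/AlgebraicGeometry/Resolution`. For a blowing up `π : X' → X` (universal property, `IsBlowup`)
of a locally Noetherian scheme along the vanishing ideal of a closed subset `Y`, a point `y ∈ Y` with REGULAR local
ring at which `𝓘_{Y,y} = 𝔪_y` (e.g. `y` the generic point of `Y`, or `Y = {y}` a closed point), and a maximal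
point `x'` of `π⁻¹(Y)` lying over `y` (a generic point of an irreducible component of the exceptional locus):

* `IsBlowup.maximalIdeal_eq_stalkIdeal_exceptional` — the maximal ideal of `𝒪_{X',x'}` IS the stalk of the
  exceptional ideal `𝓘_Y · 𝒪_{X'}`, generated by the image of one of the regular parameters `c_j` of `𝒪_{X,y}`
  (a non-zero-divisor);
* `IsBlowup.idealOrder_comap_of_mem_maxPoints` — for every ideal sheaf `J` on `X`:
  `ord_{x'}(J · 𝒪_{X'}) = ord_y(J)` (the exceptional valuation of `J` is its `𝔪_y`-adic order);
* `IsBlowup.idealOrder_controlledTransform_of_mem_maxPoints` — `ord_{x'}((J𝒪_{X'} : 𝓘_E^b)) = ord_y(J) − b`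
  (the controlled transform with control `b` loses exactly `b`; truncated subtraction in `ℕ∞`).

Proof: the chart dictionary `𝒪_{X',x'} = (B_j)_𝔴`, `B_j = 𝒪_{X,y}[𝔪/c_j]` (`IsBlowup.exists_reesChart_stalk`,
Stacks 0804); `𝔪 B_j = c_j B_j` is prime (`B_j/(c_j) ≅ k[T_l : l ≠ j]`, `chartQuotEquiv`); maximality of `x'` in
`π⁻¹(Y) = Supp(𝓘_Y 𝒪_{X'})` makes `𝔪_{x'}` minimal over the prime `c_j 𝒪_{X',x'}`, hence equal to it; an `f ∈ 𝒪_{X,y}`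
of order exactly `n` is `c_j^n · F(e)` with `F(e)` a unit at `𝔴` (`F̄(T_j := 1) ≠ 0`, `exists_chartResidueMap`).
Everything is [folklore] (Stacks 0804 / 0BIQ; the valuation of the exceptional divisor of the blowing up of a
regular centre is the order along the centre, cf. Cossart–Piltant 2008 proof of Prop. 4.2 (a), already used in
`RegularCentreBlowupOrder.lean` for the inequality at ALL points over the centre).

## Sources
* The Stacks Project, Tags 0804, 0BIQ, 01J7. [StacksProject]
* V. Cossart, O. Piltant, J. Algebra 320 (2008), proof of Prop. 4.2 (a). [CossartPiltant2008]
-/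

noncomputable section

open CategoryTheory CategoryTheory.Limits AlgebraicGeometry TopologicalSpace IsLocalRing

namespace Literature.AlgebraicGeometry.Resolution

universe u

open Scheme.IdealSheafData

variable {X X' : Scheme.{u}} {π : X' ⟶ X}

/-- In a commutative ring, if `t` is a non-zero-divisor, `u` is a unit and `t ^ n * u ∈ (t ^ (n + 1))`, false.
[folklore] -/
private theorem pow_mul_unit_not_mem_span_pow_succ {A : Type*} [CommRing A] [IsLocalRing A] {t : A}
    (ht : t ∈ nonZeroDivisors A) (htm : t ∈ maximalIdeal A) {u : A} (hu : IsUnit u) (n : ℕ) :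
    t ^ n * u ∉ Ideal.span {t ^ (n + 1)} := by
  intro h
  rw [Ideal.mem_span_singleton] at h
  obtain ⟨s, hs⟩ := h
  have h1 : t ^ n * (u - t * s) = 0 := by rw [mul_sub, hs]; ring
  have htn : t ^ n ∈ nonZeroDivisors A := pow_mem ht n
  have h2 : u - t * s = 0 := (mem_nonZeroDivisors_iff_right.mp htn) _ (by rwa [mul_comm] at h1)
  have h3 : u ∈ maximalIdeal A := by
    rw [sub_eq_zero] at h2
    rw [h2]
    exact Ideal.mul_mem_right _ _ htm
  exact (IsLocalRing.mem_maximalIdeal _).mp h3 hu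

section Core

variable {Y : Closeds X}

set_option maxHeartbeats 800000 in
-- the chart presentation of the stalk of a blowing up elaborates large terms
/-- **At a maximal point `x'` of the exceptional locus `π⁻¹(Y)` over a point `y` with regular local ring and
`𝓘_{Y,y} = 𝔪_y`, the maximal ideal of `𝒪_{X',x'}` is the stalk of the exceptional ideal `𝓘_Y·𝒪_{X'}`, and it is
generated by a non-zero-divisor which is the image of an element `c` of `𝔪_y ∖ 𝔪_y²`; moreover every `f ∈ 𝒪_{X,y}`
with `f ∈ 𝔪_y^n ∖ 𝔪_y^{n+1}` maps to `c^n ·(unit)`.** [cite: StacksProject, Tag 0804] -/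
theorem IsBlowup.exists_uniformizer_of_mem_maxPoints (hπ : IsBlowup π (vanishingIdeal Y)) {x' : X'}
    (hx' : x' ∈ maxPoints (π ⁻¹' (Y : Set X)))
    [IsRegularLocalRing (X.presheaf.stalk (π x'))]
    (hy : stalkIdeal (vanishingIdeal Y) (π x') = maximalIdeal (X.presheaf.stalk (π x'))) :
    ∃ t : X'.presheaf.stalk x',
      t ∈ nonZeroDivisors (X'.presheaf.stalk x') ∧
      maximalIdeal (X'.presheaf.stalk x') = Ideal.span {t} ∧
      stalkIdeal ((vanishingIdeal Y).comap π) x' = Ideal.span {t} ∧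
      (maximalIdeal (X.presheaf.stalk (π x'))).map (π.stalkMap x').hom = Ideal.span {t} ∧
      ∀ (n : ℕ) (f : X.presheaf.stalk (π x')),
        f ∈ maximalIdeal (X.presheaf.stalk (π x')) ^ n →
        f ∉ maximalIdeal (X.presheaf.stalk (π x')) ^ (n + 1) →
          ∃ u : X'.presheaf.stalk x', IsUnit u ∧ (π.stalkMap x').hom f = t ^ n * u := by
  classical
  -- a quasi-regular system of generators `c` of `𝔪_y`
  letI : Field ((X.presheaf.stalk (π x')) ⧸ maximalIdeal (X.presheaf.stalk (π x'))) := Ideal.Quotient.field _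
  obtain ⟨k, c, -, hcspan, hcq, -⟩ :=
    exists_isQuasiRegular_span_eq_of_isRegularLocalRing_quotient (le_refl (maximalIdeal (X.presheaf.stalk (π x'))))
      (maximalIdeal (X.presheaf.stalk (π x')) : Set (X.presheaf.stalk (π x'))) (Ideal.span_eq _)
  have hcm : ∀ l, c l ∈ maximalIdeal (X.presheaf.stalk (π x')) := fun l => hcspan ▸ Ideal.subset_span ⟨l, rfl⟩
  -- the chart presentation `𝒪_{X',x'} = (B_j)_𝔴`
  obtain ⟨j, 𝔴, χ, hχ, hloc, h𝔴⟩ := hπ.exists_reesChart_stalk x' c (hcspan.trans hy.symm)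
  letI := χ.toAlgebra
  haveI : IsLocalization.AtPrime (X'.presheaf.stalk x') 𝔴.asIdeal := hloc
  have hχalg : ∀ b, algebraMap (chartRing c j) (X'.presheaf.stalk x') b = χ b := fun b =>
    congrFun (congrArg DFunLike.coe (RingHom.algebraMap_toAlgebra χ)) b
  -- `𝔪 B_j = (c_j)`
  have hu : ∀ l, chartBase c j (c l) = chartBase c j (c j) * chartGen c j l :=
    fun l => reesChartBase_apply_eq_mul_chartGen c j l
  set K : Ideal (chartRing c j) := Ideal.span {chartBase c j (c j)} with hKdef
  have hK : (maximalIdeal (X.presheaf.stalk (π x'))).map (chartBase c j) = K := by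
    rw [← hcspan]
    exact Ideal.map_span_range_eq_span_singleton _ c j _ hu
  -- `K` is prime: `B_j ⧸ K ≅ ((X.presheaf.stalk (π x')) ⧸ 𝔪)[T]`, a domain
  haveI hKprime : K.IsPrime := by
    haveI : (Ideal.span (Set.range c)).IsMaximal := hcspan ▸ inferInstance
    letI : Field ((X.presheaf.stalk (π x')) ⧸ Ideal.span (Set.range c)) := Ideal.Quotient.field _
    haveI : IsDomain (chartRing c j ⧸ K) :=
      MulEquiv.isDomain _ (chartQuotEquiv c j hcq).symm.toMulEquiv
    exact (Ideal.Quotient.isDomain_iff_prime K).mp inferInstance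
  have hK𝔴 : K ≤ 𝔴.asIdeal := by
    rw [← hK, Ideal.map_le_iff_le_comap, h𝔴]
  -- the exceptional stalk is `K · (X'.presheaf.stalk x')`
  have hcomp : (π.stalkMap x').hom = χ.comp (chartBase c j) := by
    ext a
    exact (hχ a).symm
  have hE : stalkIdeal ((vanishingIdeal Y).comap π) x' = K.map χ := by
    rw [stalkIdeal_comap_eq_map_stalkMap, hy, hcomp, ← Ideal.map_map, hK]
  -- `K · (X'.presheaf.stalk x')` is prime (localization at `𝔴 ⊇ K`) and contracts to `K`
  have hdisj : Disjoint (𝔴.asIdeal.primeCompl : Set (chartRing c j)) (K : Set (chartRing c j)) := by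
    rw [Set.disjoint_left]
    intro b hb hbK
    exact hb (hK𝔴 hbK)
  haveI hKLprime : (K.map (algebraMap (chartRing c j) (X'.presheaf.stalk x'))).IsPrime :=
    IsLocalization.isPrime_of_isPrime_disjoint 𝔴.asIdeal.primeCompl (X'.presheaf.stalk x') K hKprime hdisj
  have hKL : K.map χ = K.map (algebraMap (chartRing c j) (X'.presheaf.stalk x')) :=
    congrArg (fun g => K.map g) (RingHom.algebraMap_toAlgebra χ).symm
  -- maximality of `x'`: `𝔪_{x'}` is a minimal prime of the exceptional stalk, hence equal to it
  have hmin : maximalIdeal (X'.presheaf.stalk x') ∈ (stalkIdeal ((vanishingIdeal Y).comap π) x').minimalPrimes := by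
    have h1 := primeOfSpecializes_mem_minimalPrimes_of_mem_maxPoints
      (Z := Y.preimage π.continuous) hx' (specializes_refl x')
    rw [primeOfSpecializes_refl, stalkIdeal_vanishingIdeal_preimage,
      ← stalkIdeal_comap_eq_map_stalkMap, Ideal.radical_minimalPrimes] at h1
    exact h1
  have hmaxE : maximalIdeal (X'.presheaf.stalk x') = stalkIdeal ((vanishingIdeal Y).comap π) x' := by
    rw [hE, hKL] at hmin ⊢
    rw [Ideal.minimalPrimes_eq_subsingleton_self] at hmin
    exact hmin
  -- the generator `t = π^♯(c_j)`
  obtain ⟨t, ht⟩ : ∃ t : X'.presheaf.stalk x', t = (π.stalkMap x').hom (c j) := ⟨_, rfl⟩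
  have htχ : t = χ (chartBase c j (c j)) := ht.trans (hχ (c j)).symm
  have hspan : K.map χ = Ideal.span {t} := by
    rw [hKdef, Ideal.map_span, Set.image_singleton, ← htχ]
  -- `t` is a non-zero-divisor: the exceptional ideal is an effective Cartier divisor
  obtain ⟨g, hg, hgspan⟩ := hπ.isEffectiveCartier.exists_stalkIdeal_eq_span x'
  have htg : Ideal.span {t} = Ideal.span {g} := by rw [← hspan, ← hE, hgspan]
  have htnzd : t ∈ nonZeroDivisors (X'.presheaf.stalk x') := by
    have h1 : t ∈ Ideal.span {g} := htg ▸ Ideal.mem_span_singleton_self t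
    have h2 : g ∈ Ideal.span {t} := htg ▸ Ideal.mem_span_singleton_self g
    obtain ⟨a, ha⟩ := Ideal.mem_span_singleton'.mp h1
    obtain ⟨b, hb⟩ := Ideal.mem_span_singleton'.mp h2
    -- `g = b t = b a g`, so `(1 - b a) g = 0`, `b a = 1`, `a` is a unit
    have h3 : (1 - b * a) * g = 0 := by
      rw [sub_mul, one_mul, mul_assoc, ha, hb, sub_self]
    have h4 : 1 - b * a = 0 := (mem_nonZeroDivisors_iff_right.mp hg) _ h3
    have ha_unit : IsUnit a := by
      rw [sub_eq_zero] at h4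
      exact IsUnit.of_mul_eq_one_right b h4.symm
    rw [← ha]
    exact mul_mem (ha_unit.mem_nonZeroDivisors) hg
  refine ⟨t, htnzd, by rw [hmaxE, hE, hspan], by rw [hE, hspan], by rw [hcomp, ← Ideal.map_map, hK, hspan],
    fun n f hfn hfn1 => ?_⟩
  -- `f = F(c)` with `F` a form of degree `n`, `F̄ ≠ 0`; on the chart `φ f = φ(c_j)^n F(e)`, `F(e) ∉ K`
  have hfP : f ∈ Ideal.span (Set.range c) ^ n := by rwa [hcspan]
  obtain ⟨F, hF, hFf⟩ := exists_isHomogeneous_of_mem_span_pow c n hfP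
  have hF0 : MvPolynomial.map (Ideal.Quotient.mk (maximalIdeal (X.presheaf.stalk (π x')))) F ≠ 0 :=
    map_residue_ne_zero_of_eval_not_mem_pow_succ c hcm hF (by rw [hFf]; exact hfn1)
  have hff' := reesChartBase_eval_eq_pow_mul_eval₂ c j hF
  rw [hFf] at hff'
  obtain ⟨ρ, -, hρker, hρF⟩ := exists_chartResidueMap c j hcq hcm
  have hFe : MvPolynomial.eval₂Hom (chartBase c j) (fun l => chartGen c j l) F ∉ K := by
    intro hmem
    have h0 : ρ (MvPolynomial.eval₂Hom (chartBase c j) (fun l => chartGen c j l) F) = 0 := by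
      rw [← RingHom.mem_ker, hρker, hK]
      exact hmem
    rw [hρF, map_dehomogenize] at h0
    exact dehomogenize_ne_zero_of_isHomogeneous j (hF.map _) hF0 h0
  -- hence `F(e)` is a unit of `(X'.presheaf.stalk x')`
  have hunit : IsUnit (χ (MvPolynomial.eval₂Hom (chartBase c j) (fun l => chartGen c j l) F)) := by
    by_contra hnu
    have hmem : χ (MvPolynomial.eval₂Hom (chartBase c j) (fun l => chartGen c j l) F) ∈ maximalIdeal (X'.presheaf.stalk x') :=
      (IsLocalRing.mem_maximalIdeal _).mpr hnu
    have key := IsLocalization.under_map_of_isPrime_disjoint 𝔴.asIdeal.primeCompl (X'.presheaf.stalk x')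
      hKprime hdisj
    rw [Ideal.under_def] at key
    rw [hmaxE, hE, hKL, ← hχalg, ← Ideal.mem_comap, key] at hmem
    exact hFe hmem
  refine ⟨_, hunit, ?_⟩
  calc (π.stalkMap x').hom f = χ (chartBase c j f) := (hχ f).symm
    _ = χ (chartBase c j (c j) ^ n *
          MvPolynomial.eval₂Hom (chartBase c j) (fun l => chartGen c j l) F) := by rw [hff']
    _ = χ (chartBase c j (c j)) ^ n *
          χ (MvPolynomial.eval₂Hom (chartBase c j) (fun l => chartGen c j l) F) := by
        rw [RingHom.map_mul, RingHom.map_pow χ (chartBase c j (c j)) n]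
    _ = t ^ n * χ (MvPolynomial.eval₂Hom (chartBase c j) (fun l => chartGen c j l) F) := by
        rw [← htχ]

/-- `I_x = 0` forces `ord_x(I) = ⊤`. [folklore] -/
private theorem idealOrder_eq_top_of_stalkIdeal_eq_bot {Z : Scheme.{u}} {I : Z.IdealSheafData} {z : Z}
    (h : stalkIdeal I z = ⊥) : idealOrder I z = ⊤ :=
  ENat.eq_top_iff_forall_ge.mpr fun n => (le_idealOrder_iff I z n).mpr (by rw [h]; exact bot_le)


-- adapted from `idealOrder_lt_top_of_stalkIdeal_ne_bot` (`KollarTripleMaxOrd.lean`; copied to keep imports light)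
/-- **Krull's intersection theorem for the order**: at a point with Noetherian local ring, an ideal sheaf with
nonzero stalk has finite order. [cite: Matsumura1987, Thm. 8.10] -/
private theorem idealOrder_ne_top_of_stalkIdeal_ne_bot {Z : Scheme.{u}} {I : Z.IdealSheafData} {z : Z}
    [IsNoetherianRing (Z.presheaf.stalk z)] (hI : stalkIdeal I z ≠ ⊥) : idealOrder I z ≠ ⊤ := by
  intro h
  apply hI
  rw [eq_bot_iff, ← Ideal.iInf_pow_eq_bot_of_isLocalRing (I := maximalIdeal (Z.presheaf.stalk z))
    (maximalIdeal.isMaximal _).ne_top]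
  refine le_iInf fun r => (le_idealOrder_iff I z r).mp ?_
  rw [h]
  exact le_top

/-- If `ord_x(I) = d` (finite) then `I_x ⊆ 𝔪^d` and `I_x ⊄ 𝔪^{d+1}`. [folklore] -/
private theorem stalkIdeal_le_pow_and_not_le_of_idealOrder_eq {Z : Scheme.{u}} {I : Z.IdealSheafData} {z : Z} {d : ℕ}
    (h : idealOrder I z = d) :
    stalkIdeal I z ≤ maximalIdeal (Z.presheaf.stalk z) ^ d ∧
      ¬ stalkIdeal I z ≤ maximalIdeal (Z.presheaf.stalk z) ^ (d + 1) := by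
  refine ⟨(le_idealOrder_iff I z d).mp h.ge, fun hle => ?_⟩
  have := (le_idealOrder_iff I z (d + 1)).mpr hle
  rw [h] at this
  exact absurd (by exact_mod_cast this : d + 1 ≤ d) (by omega)

/-- **The exceptional valuation of `J` is its order at the centre's generic point**: at a maximal point `x'` of
`π⁻¹(Y)` over `y` (regular local ring, `𝓘_{Y,y} = 𝔪_y`), for every ideal sheaf `J` on `X`,
`ord_{x'}(J · 𝒪_{X'}) = ord_y(J)`. [cite: StacksProject, Tag 0804] -/
theorem IsBlowup.idealOrder_comap_of_mem_maxPoints (hπ : IsBlowup π (vanishingIdeal Y)) {x' : X'}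
    (hx' : x' ∈ maxPoints (π ⁻¹' (Y : Set X)))
    [IsRegularLocalRing (X.presheaf.stalk (π x'))]
    (hy : stalkIdeal (vanishingIdeal Y) (π x') = maximalIdeal (X.presheaf.stalk (π x')))
    (J : X.IdealSheafData) :
    idealOrder (J.comap π) x' = idealOrder J (π x') := by
  obtain ⟨t, htnzd, hmax, -, hmap, hf⟩ := hπ.exists_uniformizer_of_mem_maxPoints hx' hy
  have htm : t ∈ maximalIdeal (X'.presheaf.stalk x') := hmax ▸ Ideal.mem_span_singleton_self t
  have hJ' : stalkIdeal (J.comap π) x' = (stalkIdeal J (π x')).map (π.stalkMap x').hom :=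
    stalkIdeal_comap_eq_map_stalkMap π J x'
  by_cases hJ : stalkIdeal J (π x') = ⊥
  · rw [idealOrder_eq_top_of_stalkIdeal_eq_bot hJ, idealOrder_eq_top_of_stalkIdeal_eq_bot]
    rw [hJ', hJ, Ideal.map_bot]
  obtain ⟨d, hd⟩ := ENat.ne_top_iff_exists.mp (idealOrder_ne_top_of_stalkIdeal_ne_bot hJ)
  obtain ⟨hle, hnot⟩ := stalkIdeal_le_pow_and_not_le_of_idealOrder_eq hd.symm
  obtain ⟨f, hfJ, hfnot⟩ := Set.not_subset.mp hnot
  obtain ⟨u, hu, hfu⟩ := hf d f (hle hfJ) hfnot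
  rw [← hd]
  apply le_antisymm
  · -- `ord ≤ d`: `π^♯ f = t^d u ∈ J'` is not in `𝔪'^{d+1}`
    by_contra hlt
    rw [not_le] at hlt
    have h1 : ((d + 1 : ℕ) : ℕ∞) ≤ idealOrder (J.comap π) x' := by
      have := Order.add_one_le_of_lt hlt
      exact_mod_cast this
    rw [le_idealOrder_iff, hJ', hmax, Ideal.span_singleton_pow] at h1
    exact pow_mul_unit_not_mem_span_pow_succ htnzd htm hu d (hfu ▸ h1 (Ideal.mem_map_of_mem _ hfJ))
  · -- `d ≤ ord`: `J' ⊆ (𝔪_y 𝒪)^d = (t)^d = 𝔪'^d`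
    rw [le_idealOrder_iff, hJ', hmax, ← hmap, ← Ideal.map_pow]
    exact Ideal.map_mono hle

/-- **The controlled transform with control `b` loses exactly `b` along the exceptional divisor**: at a maximal point
`x'` of `π⁻¹(Y)` over `y` (regular local ring, `𝓘_{Y,y} = 𝔪_y`), for every ideal sheaf `J` on `X` and `b : ℕ`,
`ord_{x'}((J·𝒪_{X'} : 𝓘_E^b)) = ord_y(J) − b` (truncated subtraction in `ℕ∞`). [cite: StacksProject, Tag 0804] -/
theorem IsBlowup.idealOrder_controlledTransform_of_mem_maxPoints [IsLocallyNoetherian X']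
    (hπ : IsBlowup π (vanishingIdeal Y)) {x' : X'}
    (hx' : x' ∈ maxPoints (π ⁻¹' (Y : Set X)))
    [IsRegularLocalRing (X.presheaf.stalk (π x'))]
    (hy : stalkIdeal (vanishingIdeal Y) (π x') = maximalIdeal (X.presheaf.stalk (π x')))
    (J : X.IdealSheafData) (b : ℕ) :
    idealOrder (controlledTransform π (vanishingIdeal Y) J b) x' = idealOrder J (π x') - b := by
  obtain ⟨t, htnzd, hmax, hexc, hmap, hf⟩ := hπ.exists_uniformizer_of_mem_maxPoints hx' hy
  have htm : t ∈ maximalIdeal (X'.presheaf.stalk x') := hmax ▸ Ideal.mem_span_singleton_self t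
  have htbnzd : ∀ m : ℕ, t ^ m ∈ nonZeroDivisors (X'.presheaf.stalk x') := fun m => pow_mem htnzd m
  -- the stalk of the controlled transform is the colon ideal `(J_y 𝒪 : t^b)`
  have hstalk : stalkIdeal (controlledTransform π (vanishingIdeal Y) J b) x' =
      Submodule.colon ((stalkIdeal J (π x')).map (π.stalkMap x').hom)
        (Ideal.span {t ^ b} : Set (X'.presheaf.stalk x')) := by
    rw [controlledTransform, stalkIdeal_colon, stalkIdeal_pow, hexc, Ideal.span_singleton_pow,
      stalkIdeal_comap_eq_map_stalkMap]
  by_cases hJ : stalkIdeal J (π x') = ⊥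
  · -- `J_y = 0`: the colon ideal is `0` too (`t^b` is a non-zero-divisor)
    rw [idealOrder_eq_top_of_stalkIdeal_eq_bot hJ, ENat.top_sub_coe, idealOrder_eq_top_of_stalkIdeal_eq_bot]
    rw [hstalk, hJ, Ideal.map_bot, eq_bot_iff]
    intro r hr
    rw [Ideal.mem_colon_span_singleton] at hr
    exact (mem_nonZeroDivisors_iff_right.mp (htbnzd b)) r hr
  obtain ⟨d, hd⟩ := ENat.ne_top_iff_exists.mp (idealOrder_ne_top_of_stalkIdeal_ne_bot hJ)
  obtain ⟨hle, hnot⟩ := stalkIdeal_le_pow_and_not_le_of_idealOrder_eq hd.symm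
  obtain ⟨f, hfJ, hfnot⟩ := Set.not_subset.mp hnot
  obtain ⟨u, hu, hfu⟩ := hf d f (hle hfJ) hfnot
  rw [← hd]
  have hsub : ((d : ℕ∞) - (b : ℕ∞)) = ((d - b : ℕ) : ℕ∞) := (ENat.coe_sub d b).symm
  rw [hsub]
  -- `J_y 𝒪 ⊆ (t^d)` and `t^d u ∈ J_y 𝒪`
  have hJ'le : (stalkIdeal J (π x')).map (π.stalkMap x').hom ≤ Ideal.span {t ^ d} := by
    rw [← Ideal.span_singleton_pow, ← hmap, ← Ideal.map_pow]
    exact Ideal.map_mono hle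
  have hmemJ' : t ^ d * u ∈ (stalkIdeal J (π x')).map (π.stalkMap x').hom :=
    hfu ▸ Ideal.mem_map_of_mem _ hfJ
  apply le_antisymm
  · -- `ord ≤ d - b`: the element `t^(d-b) u` lies in the colon ideal and not in `𝔪'^(d-b+1)`
    by_contra hlt
    rw [not_le] at hlt
    have h1 : ((d - b + 1 : ℕ) : ℕ∞) ≤ idealOrder (controlledTransform π (vanishingIdeal Y) J b) x' := by
      have := Order.add_one_le_of_lt hlt
      exact_mod_cast this
    rw [le_idealOrder_iff, hstalk, hmax, Ideal.span_singleton_pow] at h1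
    have hw : t ^ (d - b) * u ∈ Submodule.colon ((stalkIdeal J (π x')).map (π.stalkMap x').hom)
        (Ideal.span {t ^ b} : Set (X'.presheaf.stalk x')) := by
      rw [Ideal.mem_colon_span_singleton]
      have : t ^ (d - b) * u * t ^ b = t ^ (d - b + b - d) * (t ^ d * u) := by
        rw [mul_right_comm, ← pow_add, ← mul_assoc, ← pow_add]
        congr 2
        omega
      rw [this]
      exact Ideal.mul_mem_left _ _ hmemJ'
    exact pow_mul_unit_not_mem_span_pow_succ htnzd htm hu (d - b) (h1 hw)
  · -- `d - b ≤ ord`: the colon ideal lies in `(t^(d-b))`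
    rw [le_idealOrder_iff, hstalk, hmax, Ideal.span_singleton_pow]
    intro r hr
    rw [Ideal.mem_colon_span_singleton] at hr
    obtain ⟨h, hh⟩ := Ideal.mem_span_singleton'.mp (hJ'le hr)
    -- `r t^b = h t^d`
    rw [Ideal.mem_span_singleton']
    by_cases hbd : b ≤ d
    · refine ⟨h, ?_⟩
      have h2 : (r - h * t ^ (d - b)) * t ^ b = 0 := by
        rw [sub_mul, mul_assoc, ← pow_add, Nat.sub_add_cancel hbd, hh, sub_self]
      have h3 := (mem_nonZeroDivisors_iff_right.mp (htbnzd b)) _ h2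
      rw [sub_eq_zero] at h3
      rw [h3, mul_comm]
    · rw [Nat.sub_eq_zero_of_le (not_le.mp hbd).le, pow_zero]
      exact ⟨r, mul_one r⟩

end Core

end Literature.AlgebraicGeometry.Resolution

end
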